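import Literature.AlgebraicTopology.SingularHomology.WilderFiniteness
import Literature.AlgebraicTopology.SingularHomology.PoincareDuality
import Mathlib.Analysis.Convex.Contractible
import Mathlib.Analysis.Normed.Module.Convex
import Mathlib.Geometry.Manifold.ChartedSpace
import HarnessLib

/-!
# Compact manifolds have finitely generated singular homology
(discharge of `finite_singularHomology_of_compactSpace`, Hatcher Cor. A.8–A.9)

Third of three files (after `…MayerVietorisFiniteness`, `…WilderFiniteness`). A. Hatcher,
*Algebraic Topology* (2002), Appendix A, p. 527: Cor. A.8 "the homology groups … of a compact
ENR are finitely generated" and Cor. A.9 "Every compact manifold, with or without boundary, is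
an ENR"; the tree vendors the consequence for closed topological manifolds as the named fact
`Literature.AlgebraicTopology.SingularHomology.finite_singularHomology_of_compactSpace R X n k` (`…PoincareDuality`). Here it is **proved**
(`finite_singularHomology_of_compactSpace_holds`), for every Noetherian coefficient ring, by
Wilder's method (G. E. Bredon, *Sheaf Theory* (1997), §II.17) instead of ENR theory:

* `Literature.AlgebraicTopology.SingularHomology.finite_singularHomology_of_convex`, `…_biUnion_convex`: a convex subset of a real normed
  space is empty or contractible, so its homology is finitely generated; by Mayer–Vietoris
  (`openUnion.finite_singularHomology`) and induction, so is the homology of a finite union of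
  convex open sets (the intersections `C ∩ Cᵢ` are again convex);
* `Literature.AlgebraicTopology.SingularHomology.hasFGInclRanges_of_normedSpace`: every open subset `U` of a real normed space satisfies
  Wilder's condition `Q(U)` — a compact `closure V ⊆ U` is covered by finitely many balls inside
  `U`, and `Hₙ(V) → Hₙ(U)` factors through the finitely generated homology of their union;
* `Literature.AlgebraicTopology.SingularHomology.finite_singularHomology_of_compact_chartedSpace`: for `X` compact Hausdorff with an atlas
  modelled on `EuclideanSpace ℝ (Fin d)`, chart sources are hereditarily `Q` (transport along the
  chart composed with `Homeomorph.ulift`, to stay in the universe of `X`), finitely many cover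
  `X`, so `Q(univ)` (`HereditarilyHasFGInclRanges.biUnion_finset`) and `Hₖ(X; M)` is finitely
  generated for every finitely generated coefficient module `M`;
* `Literature.AlgebraicTopology.SingularHomology.finite_singularHomology_of_compactSpace_holds`: the named fact, `M = R`.

## References

* A. Hatcher, *Algebraic Topology*, CUP 2002, Appendix A, Cor. A.8 and A.9 (p. 527); §2.2
  pp. 149–150. [HatcherAT2002]
* G. E. Bredon, *Sheaf Theory*, 2nd ed., GTM 170, Springer 1997, §II.17, Thm. 17.4,
  Cor. 17.7. [Bredon1997]
-/

noncomputable section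

open CategoryTheory Limits Set

universe u v

namespace Literature.AlgebraicTopology.SingularHomology

variable (R : Type v) [CommRing R] (M : Type v) [AddCommGroup M] [Module R M]

/-! ### Euclidean space: finite unions of convex open sets -/

section Euclidean

variable {E : Type u} [NormedAddCommGroup E] [NormedSpace ℝ E]

/-- A convex subset of a real normed space has finitely generated homology with coefficients in a
finitely generated module: it is empty (all homology vanishes) or contractible
(`Convex.contractibleSpace`; `H₀ ≅ M`, `Hₙ = 0` for `n > 0`, Hatcher 2002, Prop. 2.7–2.8 with
Cor. 2.11). [folklore] -/
theorem finite_singularHomology_of_convex [Module.Finite R M] {C : Set E} (hC : Convex ℝ C)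
    (n : ℕ) : Module.Finite R (singularHomology R M C n) := by
  rcases C.eq_empty_or_nonempty with rfl | hne
  · haveI := ModuleCat.subsingleton_of_isZero (isZero_singularHomology_empty (R := R) (M := M)
      (X := E) n)
    infer_instance
  · haveI := hC.contractibleSpace hne
    rcases Nat.eq_zero_or_pos n with rfl | hn
    · haveI := singularHomology.isIso_ε_of_contractibleSpace R M (X := ↥C)
      exact Module.Finite.equiv (asIso (singularHomology.ε R M ↥C)).toLinearEquiv.symm
    · haveI := ModuleCat.subsingleton_of_isZero
        (isZero_singularHomology_of_contractibleSpace R M (X := ↥C) hn.ne')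
      infer_instance

/-- **A finite union of convex open subsets of a real normed space has finitely generated
homology** (Noetherian coefficient ring, finitely generated coefficients): induction on the
number of sets with `openUnion.finite_singularHomology`, the intersection of `C` with a union of
convex open sets being the union of the convex open sets `C ∩ Cᵢ` (the step "(2) `K` a finite
union of convex subsets" of the classical bootstrap; Bredon 1997, II.17, proof of 17.4). [folklore] -/
theorem finite_singularHomology_biUnion_convex [IsNoetherianRing R] [Module.Finite R M]
    {ι : Type*} (s : Finset ι) :
    ∀ (C : ι → Set E), (∀ i ∈ s, IsOpen (C i)) → (∀ i ∈ s, Convex ℝ (C i)) →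
      ∀ n, Module.Finite R (singularHomology R M (↥(⋃ i ∈ s, C i)) n) := by
  classical
  induction s using Finset.induction_on with
  | empty =>
    intro C _ _ n
    rw [show (⋃ i ∈ (∅ : Finset ι), C i) = ∅ by simp]
    exact finite_singularHomology_of_convex R M (convex_empty (𝕜 := ℝ) (E := E)) n
  | insert a s ha ih =>
    intro C hCo hCc n
    rw [Finset.set_biUnion_insert]
    have hso : IsOpen (⋃ i ∈ s, C i) :=
      isOpen_biUnion fun i hi ↦ hCo i (Finset.mem_insert_of_mem hi)
    refine openUnion.finite_singularHomology R M (hCo a (Finset.mem_insert_self a s)) hso n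
      (finite_singularHomology_of_convex R M (hCc a (Finset.mem_insert_self a s)) n)
      (ih C (fun i hi ↦ hCo i (Finset.mem_insert_of_mem hi))
        (fun i hi ↦ hCc i (Finset.mem_insert_of_mem hi)) n) (fun m _ ↦ ?_)
    rw [inter_iUnion₂]
    exact ih (fun i ↦ C a ∩ C i)
      (fun i hi ↦ (hCo a (Finset.mem_insert_self a s)).inter (hCo i (Finset.mem_insert_of_mem hi)))
      (fun i hi ↦ (hCc a (Finset.mem_insert_self a s)).inter (hCc i (Finset.mem_insert_of_mem hi)))
      m

/-- **Every open subset of a real normed space satisfies Wilder's condition `Q`** (the homology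
analogue of `(jⁿ)` for Euclidean space, Bredon 1997, II.17): if `closure V ⊆ U` is compact, cover
it by finitely many open balls contained in `U`; then `Hₙ(V) → Hₙ(U)` factors through the
finitely generated `Hₙ` of their union (`finite_singularHomology_biUnion_convex`), so its image is
finitely generated. [folklore] -/
theorem hasFGInclRanges_of_normedSpace [IsNoetherianRing R] [Module.Finite R M] (U : Set E)
    (hU : IsOpen U) : HasFGInclRanges R M U := by
  intro V hV hVc hVU n
  have hball : ∀ x ∈ closure V, ∃ r > 0, Metric.ball x r ⊆ U := fun x hx ↦
    Metric.isOpen_iff.mp hU x (hVU hx)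
  choose! r hr hrU using hball
  obtain ⟨t, htV, ht⟩ := hVc.elim_nhds_subcover (fun x ↦ Metric.ball x (r x))
    (fun x hx ↦ Metric.ball_mem_nhds x (hr x hx))
  have hWU : (⋃ x ∈ t, Metric.ball x (r x)) ⊆ U :=
    iUnion₂_subset fun x hx ↦ hrU x (htV x hx)
  have hVW : V ⊆ ⋃ x ∈ t, Metric.ball x (r x) := subset_closure.trans ht
  haveI := finite_singularHomology_biUnion_convex R M t (fun x ↦ Metric.ball x (r x))
    (fun x _ ↦ Metric.isOpen_ball) (fun x _ ↦ convex_ball x (r x)) n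
  change (inclRange R M (hVW.trans hWU) n).FG
  rw [inclRange_trans hVW hWU]
  exact (Submodule.fg_range (singularHomology.map R M (subsetInclusion hWU) n).hom).of_le
    LinearMap.map_le_range

end Euclidean

/-! ### Compact manifolds -/

section Manifold

variable {X : Type u} [TopologicalSpace X]

/-- **The singular homology of a compact manifold is finitely generated** (Hatcher 2002, App. A,
Cor. A.8 with Cor. A.9, p. 527; proved by Wilder's method, Bredon 1997, II.17, Thm. 17.4 and
Cor. 17.7): for `X` compact Hausdorff with an atlas modelled on `EuclideanSpace ℝ (Fin d)`, a
Noetherian ring `R` and a finitely generated `R`-module `M`, every `Hₖ(X; M)` is a finitely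
generated `R`-module. Chart sources are hereditarily `Q` (`HasFGInclRanges.of_openPartialHomeomorph`
with `hasFGInclRanges_of_normedSpace` for `ULift (EuclideanSpace ℝ (Fin d))`), finitely many cover
`X`, so `Q(univ)` holds (`HereditarilyHasFGInclRanges.biUnion_finset`), and `V = univ` has compact
closure. [cite: HatcherAT2002, App. A Cor. A.8 and A.9 p. 527] -/
theorem finite_singularHomology_of_compact_chartedSpace [IsNoetherianRing R] [Module.Finite R M]
    {d : ℕ} [CompactSpace X] [T2Space X] [ChartedSpace (EuclideanSpace ℝ (Fin d)) X] (k : ℕ) :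
    Module.Finite R (singularHomology R M X k) := by
  haveI := ChartedSpace.locallyCompactSpace (EuclideanSpace ℝ (Fin d)) X
  have hchart : ∀ x : X, HereditarilyHasFGInclRanges R M
      (chartAt (EuclideanSpace ℝ (Fin d)) x).source := by
    intro x W hW hWo
    exact HasFGInclRanges.of_openPartialHomeomorph
      ((chartAt (EuclideanSpace ℝ (Fin d)) x).transHomeomorph
        (Homeomorph.ulift.{u} (X := EuclideanSpace ℝ (Fin d))).symm)
      (fun U' hU' ↦ hasFGInclRanges_of_normedSpace R M U' hU') hWo
      (by rwa [OpenPartialHomeomorph.transHomeomorph_source])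
  obtain ⟨t, ht⟩ := isCompact_univ.elim_finite_subcover
    (fun x : X ↦ (chartAt (EuclideanSpace ℝ (Fin d)) x).source)
    (fun x ↦ (chartAt (EuclideanSpace ℝ (Fin d)) x).open_source)
    (fun x _ ↦ mem_iUnion.mpr ⟨x, mem_chart_source _ x⟩)
  have huniv : HereditarilyHasFGInclRanges R M
      (⋃ x ∈ t, (chartAt (EuclideanSpace ℝ (Fin d)) x).source) :=
    HereditarilyHasFGInclRanges.biUnion_finset t _
      (fun x _ ↦ (chartAt (EuclideanSpace ℝ (Fin d)) x).open_source) (fun x _ ↦ hchart x)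
  have hQ : HasFGInclRanges R M (univ : Set X) := huniv (subset_univ _ |>.trans ht) isOpen_univ
  have hfg := hQ isOpen_univ (by rw [closure_univ]; exact isCompact_univ)
    (by rw [closure_univ]) k
  have hid : subsetInclusion (subset_closure.trans (by rw [closure_univ]) :
      (univ : Set X) ⊆ univ) = ContinuousMap.id _ := rfl
  rw [inclRange, hid, singularHomology.map_id] at hfg
  haveI : Module.Finite R (singularHomology R M (↥(univ : Set X)) k) :=
    ⟨by simpa [LinearMap.range_eq_top] using hfg⟩
  exact finite_singularHomology_of_homeomorph (Homeomorph.Set.univ X) k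

/-- **Discharge of the named fact `Literature.AlgebraicTopology.SingularHomology.finite_singularHomology_of_compactSpace`**
(`…PoincareDuality`; Hatcher 2002, App. A, Cor. A.8 and A.9, p. 527): the homology `Hₖ(X; R)` of
a closed topological `n`-manifold is a finitely generated `R`-module, for `R` Noetherian — the
case `M = R` of `finite_singularHomology_of_compact_chartedSpace`. [cite: HatcherAT2002, App. A Cor. A.8 and A.9 p. 527] -/
theorem finite_singularHomology_of_compactSpace_holds (X : Type u) [TopologicalSpace X] (n : ℕ)
    [IsNoetherianRing R] [CompactSpace X] [T2Space X] [ChartedSpace (EuclideanSpace ℝ (Fin n)) X]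
    (k : ℕ) : finite_singularHomology_of_compactSpace R X n k :=
  finite_singularHomology_of_compact_chartedSpace R R (d := n) k

end Manifold

end Literature.AlgebraicTopology.SingularHomology
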